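import Mathlib
import Literature.Analysis.Convexity.DinesYuan
import Literature.Combinatorics.SimpleGraph.LovaszThetaDual
import Literature.Computation.Certificates.SemidefiniteComplementarity
import HarnessLib

/-!
# Semidefinite relaxation of a homogeneous QCQP and its S-procedure certificate
# (Chester–Landry–Liu–Poland–Simmons-Duffin–Su–Vichi 2020, §3.3–§3.4.3)

Source: S. M. Chester, W. Landry, J. Liu, D. Poland, D. Simmons-Duffin, N. Su, A. Vichi,
*Carving out OPE space and precise O(2) model critical exponents*, JHEP 06 (2020) 142,
arXiv:1912.03324 [ChesterEtAl2020] (held text read: §3.3 "cutting surface" algorithm — the sets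
`U_i`, the region `𝒜_n`, Algorithm 1; §3.4 the QCQP; §3.4.3 "Semidefinite relaxation and rank
minimization").  Background: Blekherman–Parrilo–Thomas (eds.), *Semidefinite Optimization and
Convex Algebraic Geometry*, SIAM 2012 [BlekhermanParriloThomas2012], Ch. 2 §2.1 Thm 2.28 /
Exercise 2.32 (for a proper cone `K` and a linear map `A`: `K ∩ ker A = {0}` iff `A* y ∈ int K*`
for some `y` — "infeasibility certificates"); Pólik–Terlaky, *A survey of the S-lemma*, SIAM
Rev. 49 (2007) 371–418 [PolikTerlaky2007] (§1.1: the S-procedure = the LMI relaxation of a system of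
quadratic inequalities; Lemma 2.7 = Yuan's lemma; §3.3: counterexamples with three or more forms).
NOTATION: below `m` is the DIMENSION (as in the paper) and `K` the NUMBER OF FORMS;
Pólik–Terlaky's `m` counts the constraints `gᵢ ≤ 0` next to `f < 0` (their `m` is our `K − 1`).

SETTING (§3.3 of the paper).  The OPE-space scan produces real quadratic forms `Q₁, …, Q_K` on
`ℝ^m` (`m = 4` there); `Q_i` EXCLUDES the directions `U_i = {[λ] ∈ ℝℙ^{m-1} : λᵀ Q_i λ ≥ 0}`, the
allowed region is `𝒜 = ℝℙ^{m-1} ∖ ⋃ U_i = {[λ] : λᵀ Q_i λ < 0 ∀ i}`, and Algorithm 1 terminates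
("disallowed") exactly when `𝒜 = ∅`.  We work with representatives:
`allowed Q = {x ≠ 0 | ∀ i, xᵀ Q_i x < 0} ⊆ ℝ^m`, a union of punctured lines
(`smul_mem_allowed_iff`).

CONTENTS.
* §1 `excluded`, `allowed`; the QCQP of §3.4.3 (`IsQCQPSolution Q x`: `x ≠ 0 ∧ ∀ i, xᵀQ_ix ≤ 0`)
  and its SEMIDEFINITE RELAXATION `IsRelaxedSolution Q X`: `X ⪰ 0 ∧ X ≠ 0 ∧ ∀ i, Tr(X Q_i) ≤ 0`
  — the paper's "Find `X ⪰ 0` such that `Tr(X Q_i) ≤ 0` … and `rank(X) = 1`" with the rank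
  condition dropped; `X ≠ 0` is what remains of `rank X = 1` (without it `X = 0` is always
  feasible); equivalently `Tr X = 1` (`exists_isRelaxedSolution_iff`).  `x xᵀ` relaxes a QCQP
  solution (`isRelaxedSolution_vecMulVec`), so "if the semidefinite relaxation is infeasible …
  the original QCQP is necessarily infeasible.  Thus, we can rigorously conclude that `𝒜_n` is
  empty" (`allowed_eq_empty_of_relaxation_infeasible`).
* §2 CERTIFICATES (the S-procedure): multipliers `τ ≥ 0` with `∑ τ_i Q_i ≻ 0`
  (`IsStrictCertificate`) refute the relaxation — `Tr(X ∑ τ_i Q_i) > 0` for `X ⪰ 0, X ≠ 0`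
  against `∑ τ_i Tr(X Q_i) ≤ 0` (`relaxation_infeasible_of_strictCertificate`) — so every
  direction is STRICTLY excluded (`exists_pos_of_strictCertificate`); multipliers `τ ≥ 0`,
  `τ ≠ 0` with `∑ τ_i Q_i ⪰ 0` (`IsWeakCertificate`) already force `allowed Q = ∅`
  (`allowed_eq_empty_of_weakCertificate`).  These are the finitely checkable objects (exact
  `LDLᵀ` of `∑ τ_i Q_i` for rational `τ`).
* §3 COMPLETENESS of the strict certificate for the RELAXATION, any `K` (Blekherman–Parrilo–
  Thomas Thm 2.28 (i)⇔(ii) for the cone `S^m_+ × ℝ^K_+`): the relaxation is infeasible IFF a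
  strict certificate exists (`relaxation_infeasible_iff_exists_strictCertificate`), proved by
  separating the compact convex image `{(Tr(B Q_i))_i : B ⪰ 0, Tr B = 1}` of the spectraplex
  (`IsSpectraplex`, `isCompact_setOf_isSpectraplex` of `LovaszThetaDual.lean`) from the closed
  convex nonpositive orthant (`geometric_hahn_banach_compact_closed`).  "SDP relaxation
  infeasible" and "a positive definite nonnegative combination exists" are the same test; the
  latter is the certificate to record.
* §4 TWO FORMS (`K = 2`, any `m`): `allowed (A, B) = ∅` iff a weak certificate exists, by Yuan's
  lemma (`yuan_lemma'`, Pólik–Terlaky Lemma 2.7) — `allowed_pair_eq_empty_iff`.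
* §5 THE GAP for more than two forms (Pólik–Terlaky §3.3 "Counterexamples": §3.3.1 four forms
  on `ℝ³` — "the generalization to the case `m ≥ 3` is practically hopeless", Lemmas 3.11–3.12 —
  and §3.3.2 / Prop. 3.13 three forms on `ℝ²`): here four forms on `ℝ²`, `Q_i = ¼·1 − u_i u_iᵀ`
  for the lines `u_i` at 0°, 90°, 45°, 135° — every direction is strictly excluded (`ex_cover`),
  yet `X = 1` solves the relaxation (`ex_isRelaxedSolution`) and no weak (a fortiori no strict)
  certificate exists (`ex_no_weakCertificate`, the proof pattern of Lemma 3.12):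
  relaxation-infeasibility is SUFFICIENT, not necessary, for `𝒜 = ∅` — the status the paper
  gives it ("non-rigorous (except when `m = 2`)", i.e. except for a one-dimensional OPE space
  `ℝℙ¹`; rigorous emptiness only through the relaxation).

NOT here: the cutting-surface iteration itself (choice and centering of `λ_{n+1}`, affine
rescaling, §3.4.1–§3.4.2, §3.4.4), rank minimisation and random sampling (§3.4.3, feasible case),
and the semidefinite program producing the forms `Q_i = α_i(V_ext)` (anchors
`ConformalBootstrap3D/OPEAngleScan`, `QuantumFieldTheory/O2ThreeScalarCrossing`).
-/

namespace Literature.Analysis.Convexity.SemidefiniteRelaxationQCQP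

open Matrix Finset
open Literature.Combinatorics.SimpleGraph (IsSpectraplex isCompact_setOf_isSpectraplex
  trace_mul_nonneg_of_posSemidef)
open Literature.Computation.Certificates.SemidefiniteComplementarity (trace_mul_eq_zero_iff)

variable {n : Type*} [Fintype n] [DecidableEq n] {ι : Type*} [Fintype ι]

/-! ## 1. Excluded neighbourhoods, the allowed region, the QCQP and its relaxation -/

omit [DecidableEq n] in
/-- `xᵀ Q x` is quadratic under scaling: `(c x)ᵀ Q (c x) = c² xᵀ Q x`.
[cite: ChesterEtAl2020, §3.3 (the `U_i` are subsets of projective space `ℝℙ^{m-1}`)] -/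
theorem quad_smul (Q : Matrix n n ℝ) (c : ℝ) (x : n → ℝ) :
    (c • x) ⬝ᵥ Q *ᵥ (c • x) = c ^ 2 * (x ⬝ᵥ Q *ᵥ x) := by
  rw [mulVec_smul, dotProduct_smul, smul_dotProduct, smul_eq_mul, smul_eq_mul]; ring

/-- The neighbourhood EXCLUDED by a form `Q`: `U = {λ : λᵀ Q λ ≥ 0}` ("`α₁` rules out an entire
neighborhood `U₁`"), on representatives `λ ∈ ℝ^m`.
[cite: ChesterEtAl2020, §3.3 (definition of `U_i`)] -/
def excluded (Q : Matrix n n ℝ) : Set (n → ℝ) := {x | 0 ≤ x ⬝ᵥ Q *ᵥ x}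

/-- The ALLOWED region `𝒜_n = ℝℙ^{m-1} ∖ ⋃ᵢ U_i`, on representatives: the nonzero `x` with
`xᵀ Q_i x < 0` for every `i`. [cite: ChesterEtAl2020, §3.3 (definition of `𝒜_n`)] -/
def allowed (Q : ι → Matrix n n ℝ) : Set (n → ℝ) := {x | x ≠ 0 ∧ ∀ i, x ⬝ᵥ Q i *ᵥ x < 0}

omit [DecidableEq n] [Fintype ι] in
/-- `𝒜_n = (ℝ^m ∖ 0) ∖ ⋃ᵢ U_i`. [cite: ChesterEtAl2020, §3.3 (definition of `𝒜_n`)] -/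
theorem allowed_eq (Q : ι → Matrix n n ℝ) :
    allowed Q = {x | x ≠ 0} \ ⋃ i, excluded (Q i) := by
  ext x
  simp [allowed, excluded, not_le]

omit [DecidableEq n] [Fintype ι] in
/-- `allowed Q` is a union of punctured lines (a subset of projective space): `c x ∈ 𝒜 ↔ x ∈ 𝒜`
for `c ≠ 0`. [cite: ChesterEtAl2020, §3.3 (`𝒜_n ⊆ ℝℙ^{m-1}`)] -/
theorem smul_mem_allowed_iff (Q : ι → Matrix n n ℝ) {c : ℝ} (hc : c ≠ 0) (x : n → ℝ) :
    c • x ∈ allowed Q ↔ x ∈ allowed Q := by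
  have hc2 : 0 < c ^ 2 := by positivity
  simp only [allowed, Set.mem_setOf_eq, quad_smul]
  constructor
  · rintro ⟨h0, h⟩
    refine ⟨fun hx => h0 (by rw [hx, smul_zero]), fun i => ?_⟩
    by_contra hq
    exact absurd (h i) (not_lt.mpr (mul_nonneg hc2.le (not_lt.mp hq)))
  · rintro ⟨h0, h⟩
    exact ⟨smul_ne_zero hc h0, fun i => mul_neg_of_pos_of_neg hc2 (h i)⟩

/-- The QCQP of §3.4.3: "find `x` such that `xᵀ Q_i x ≤ 0` for all `i`" (a nonzero `x`;
"equivalent to `[x] ∈ 𝒜_n`" up to the boundary `xᵀ Q_i x = 0`).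
[cite: ChesterEtAl2020, §3.4.3 (the QCQP)] -/
def IsQCQPSolution (Q : ι → Matrix n n ℝ) (x : n → ℝ) : Prop :=
  x ≠ 0 ∧ ∀ i, x ⬝ᵥ Q i *ᵥ x ≤ 0

omit [DecidableEq n] [Fintype ι] in
/-- A point of the allowed region solves the QCQP. [cite: ChesterEtAl2020, §3.4.3 (the QCQP)] -/
theorem isQCQPSolution_of_mem_allowed {Q : ι → Matrix n n ℝ} {x : n → ℝ} (hx : x ∈ allowed Q) :
    IsQCQPSolution Q x :=
  ⟨hx.1, fun i => (hx.2 i).le⟩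

/-- The SEMIDEFINITE RELAXATION: "Find `X ⪰ 0` such that `Tr(X Q_i) ≤ 0` for all `i` [and
`rank X = 1`]" with the rank-one condition removed (`X ≠ 0` kept).
[cite: ChesterEtAl2020, §3.4.3 (semidefinite relaxation of the QCQP)] -/
def IsRelaxedSolution (Q : ι → Matrix n n ℝ) (X : Matrix n n ℝ) : Prop :=
  X.PosSemidef ∧ X ≠ 0 ∧ ∀ i, (X * Q i).trace ≤ 0

omit [DecidableEq n] in
/-- `Tr(x xᵀ M) = xᵀ M x`. [cite: ChesterEtAl2020, §3.4.3 ("it can be written `X = x xᵀ`")] -/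
theorem trace_vecMulVec_mul (x : n → ℝ) (M : Matrix n n ℝ) :
    (vecMulVec x x * M).trace = x ⬝ᵥ M *ᵥ x := by
  rw [vecMulVec_mul, trace_vecMulVec, dotProduct_mulVec]
  exact dotProduct_comm _ _

omit [Fintype n] [DecidableEq n] in
/-- `x xᵀ ≠ 0` for `x ≠ 0`. [cite: ChesterEtAl2020, §3.4.3 (`rank(X) = 1`)] -/
theorem vecMulVec_self_ne_zero {x : n → ℝ} (hx : x ≠ 0) : vecMulVec x x ≠ 0 := by
  obtain ⟨i, hi⟩ := Function.ne_iff.mp hx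
  intro h
  have h' : x i * x i = 0 := by simpa [vecMulVec_apply] using congr_fun (congr_fun h i) i
  exact hi (by simpa using mul_self_eq_zero.mp h')

omit [DecidableEq n] [Fintype ι] in
/-- A QCQP solution `x` gives the relaxed solution `X = x xᵀ`.
[cite: ChesterEtAl2020, §3.4.3 ("If such an `X` exists, then it can be written `X = x xᵀ`")] -/
theorem isRelaxedSolution_vecMulVec {Q : ι → Matrix n n ℝ} {x : n → ℝ}
    (hx : IsQCQPSolution Q x) : IsRelaxedSolution Q (vecMulVec x x) :=
  ⟨by simpa using posSemidef_vecMulVec_self_star x, vecMulVec_self_ne_zero hx.1,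
    fun i => by rw [trace_vecMulVec_mul]; exact hx.2 i⟩

omit [DecidableEq n] [Fintype ι] in
/-- "The semidefinite relaxation is infeasible … In this case, the original QCQP is necessarily
infeasible." [cite: ChesterEtAl2020, §3.4.3 (first outcome)] -/
theorem not_isQCQPSolution_of_relaxation_infeasible {Q : ι → Matrix n n ℝ}
    (h : ∀ X, ¬ IsRelaxedSolution Q X) (x : n → ℝ) : ¬ IsQCQPSolution Q x :=
  fun hx => h _ (isRelaxedSolution_vecMulVec hx)

omit [DecidableEq n] [Fintype ι] in
/-- "… Thus, we can rigorously conclude that `𝒜_n` is empty."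
[cite: ChesterEtAl2020, §3.4.3 (first outcome)] -/
theorem allowed_eq_empty_of_relaxation_infeasible {Q : ι → Matrix n n ℝ}
    (h : ∀ X, ¬ IsRelaxedSolution Q X) : allowed Q = ∅ :=
  Set.eq_empty_of_subset_empty fun x hx =>
    (not_isQCQPSolution_of_relaxation_infeasible h x (isQCQPSolution_of_mem_allowed hx)).elim

omit [DecidableEq n] [Fintype ι] in
/-- The relaxation in normalised (SDP) form: it is feasible iff some `B ⪰ 0` with `Tr B = 1`
(a point of the spectraplex) has `Tr(B Q_i) ≤ 0` for all `i`.
[cite: ChesterEtAl2020, §3.4.3 (semidefinite relaxation; homogeneity in `X`)] -/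
theorem exists_isRelaxedSolution_iff (Q : ι → Matrix n n ℝ) :
    (∃ X, IsRelaxedSolution Q X) ↔ ∃ B, IsSpectraplex B ∧ ∀ i, (B * Q i).trace ≤ 0 := by
  constructor
  · rintro ⟨X, hX, hX0, hle⟩
    have htr : 0 < X.trace :=
      lt_of_le_of_ne hX.trace_nonneg fun h => hX0 (hX.trace_eq_zero_iff.mp h.symm)
    refine ⟨X.trace⁻¹ • X, IsSpectraplex.of_posSemidef_div hX htr, fun i => ?_⟩
    rw [Matrix.smul_mul, trace_smul, smul_eq_mul]
    exact mul_nonpos_of_nonneg_of_nonpos (inv_nonneg.mpr htr.le) (hle i)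
  · rintro ⟨B, hB, hle⟩
    refine ⟨B, hB.posSemidef, fun h => ?_, hle⟩
    have h1 := hB.trace_eq_one
    rw [h, trace_zero] at h1
    exact zero_ne_one h1

/-! ## 2. Certificates: the S-procedure -/

/-- A STRICT certificate: multipliers `τ ≥ 0` with `∑ τ_i Q_i ≻ 0` (the LMI of the S-procedure,
strict form). [cite: PolikTerlaky2007, §1.1 (the S-procedure: an LMI relaxation)] -/
def IsStrictCertificate (Q : ι → Matrix n n ℝ) (τ : ι → ℝ) : Prop :=
  (∀ i, 0 ≤ τ i) ∧ (∑ i, τ i • Q i).PosDef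

/-- A WEAK certificate: multipliers `τ ≥ 0`, not all zero, with `∑ τ_i Q_i ⪰ 0`.
[cite: PolikTerlaky2007, §1.1 (the S-procedure) and Lemma 2.7 (Yuan)] -/
def IsWeakCertificate (Q : ι → Matrix n n ℝ) (τ : ι → ℝ) : Prop :=
  (∀ i, 0 ≤ τ i) ∧ (∃ i, 0 < τ i) ∧ (∑ i, τ i • Q i).PosSemidef

omit [DecidableEq n] in
/-- `xᵀ (∑ τ_i Q_i) x = ∑ τ_i xᵀ Q_i x`. [cite: PolikTerlaky2007, §2.1 (2.3) (`∑ yᵢ gᵢ(x)`)] -/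
theorem quad_sum_smul (τ : ι → ℝ) (Q : ι → Matrix n n ℝ) (x : n → ℝ) :
    x ⬝ᵥ (∑ i, τ i • Q i) *ᵥ x = ∑ i, τ i * (x ⬝ᵥ Q i *ᵥ x) := by
  rw [Matrix.sum_mulVec, dotProduct_sum]
  refine Finset.sum_congr rfl fun i _ => ?_
  rw [smul_mulVec, dotProduct_smul, smul_eq_mul]

omit [DecidableEq n] in
/-- `Tr(X ∑ τ_i Q_i) = ∑ τ_i Tr(X Q_i)`. [cite: PolikTerlaky2007, §2.3 (2.30) (LMI relaxation)] -/
theorem trace_mul_sum_smul (X : Matrix n n ℝ) (τ : ι → ℝ) (Q : ι → Matrix n n ℝ) :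
    (X * ∑ i, τ i • Q i).trace = ∑ i, τ i * (X * Q i).trace := by
  rw [Finset.mul_sum, trace_sum]
  exact Finset.sum_congr rfl fun i _ => by rw [Matrix.mul_smul, trace_smul, smul_eq_mul]

/-- `Tr(X P) > 0` for `X ⪰ 0`, `X ≠ 0`, `P ≻ 0` ("the scalar product of positive semidefinite
matrices is nonnegative", and it vanishes only if `X P = 0`).
[cite: BlekhermanParriloThomas2012, App. A Cor. A.24 with Prop. A.21] -/
theorem trace_mul_pos {X P : Matrix n n ℝ} (hX : X.PosSemidef) (hX0 : X ≠ 0) (hP : P.PosDef) :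
    0 < (X * P).trace := by
  refine lt_of_le_of_ne (trace_mul_nonneg_of_posSemidef hX hP.posSemidef) fun h => hX0 ?_
  exact hP.isUnit.mul_left_eq_zero.mp ((trace_mul_eq_zero_iff hX hP.posSemidef).mp h.symm)

/-- SOUNDNESS of the strict certificate: `τ ≥ 0`, `∑ τ_i Q_i ≻ 0` ⟹ the relaxation is infeasible
(`0 < Tr(X ∑ τ_i Q_i) = ∑ τ_i Tr(X Q_i) ≤ 0` is absurd).
[cite: PolikTerlaky2007, §1.1 (the S-procedure: the LMI certifies unsolvability)] -/
theorem relaxation_infeasible_of_strictCertificate {Q : ι → Matrix n n ℝ} {τ : ι → ℝ}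
    (hτ : IsStrictCertificate Q τ) (X : Matrix n n ℝ) : ¬ IsRelaxedSolution Q X := by
  rintro ⟨hX, hX0, hle⟩
  have hpos := trace_mul_pos hX hX0 hτ.2
  rw [trace_mul_sum_smul] at hpos
  exact absurd hpos (not_lt.mpr (Finset.sum_nonpos fun i _ =>
    mul_nonpos_of_nonneg_of_nonpos (hτ.1 i) (hle i)))

/-- A strict certificate excludes every direction STRICTLY: each `x ≠ 0` has `xᵀ Q_i x > 0` for
some `i` (it lies in the interior of some `U_i`).
[cite: ChesterEtAl2020, §3.3 (`ℝℙ^{m-1} = ⋃ U_i`: termination of Algorithm 1)] -/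
theorem exists_pos_of_strictCertificate {Q : ι → Matrix n n ℝ} {τ : ι → ℝ}
    (hτ : IsStrictCertificate Q τ) {x : n → ℝ} (hx : x ≠ 0) : ∃ i, 0 < x ⬝ᵥ Q i *ᵥ x := by
  by_contra h
  push Not at h
  exact relaxation_infeasible_of_strictCertificate hτ _ (isRelaxedSolution_vecMulVec ⟨hx, h⟩)

/-- A strict certificate proves `𝒜 = ∅`. [cite: ChesterEtAl2020, §3.4.3 (first outcome)] -/
theorem allowed_eq_empty_of_strictCertificate {Q : ι → Matrix n n ℝ} {τ : ι → ℝ}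
    (hτ : IsStrictCertificate Q τ) : allowed Q = ∅ :=
  allowed_eq_empty_of_relaxation_infeasible (relaxation_infeasible_of_strictCertificate hτ)

omit [DecidableEq n] in
/-- SOUNDNESS of the weak certificate: `τ ≥ 0`, `τ ≠ 0`, `∑ τ_i Q_i ⪰ 0` ⟹ every `x` has
`xᵀ Q_i x ≥ 0` for some `i` (else `∑ τ_i xᵀ Q_i x < 0`).
[cite: PolikTerlaky2007, §1.1 (the S-procedure) and Lemma 2.7] -/
theorem exists_nonneg_of_weakCertificate {Q : ι → Matrix n n ℝ} {τ : ι → ℝ}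
    (hτ : IsWeakCertificate Q τ) (x : n → ℝ) : ∃ i, 0 ≤ x ⬝ᵥ Q i *ᵥ x := by
  obtain ⟨h0, ⟨j, hj⟩, hpsd⟩ := hτ
  by_contra h
  push Not at h
  have hq := hpsd.dotProduct_mulVec_nonneg x
  rw [star_trivial, quad_sum_smul] at hq
  have hlt : ∑ i, τ i * (x ⬝ᵥ Q i *ᵥ x) < ∑ _i : ι, (0 : ℝ) :=
    Finset.sum_lt_sum (fun i _ => mul_nonpos_of_nonneg_of_nonpos (h0 i) (h i).le)
      ⟨j, Finset.mem_univ _, mul_neg_of_pos_of_neg hj (h j)⟩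
  rw [Finset.sum_const_zero] at hlt
  exact absurd hq (not_le.mpr hlt)

omit [DecidableEq n] in
/-- A weak certificate proves `𝒜 = ∅` (every direction lies in some closed `U_i`).
[cite: ChesterEtAl2020, §3.3 (`𝒜_n = ∅` iff `ℝℙ^{m-1} = ⋃ U_i`)] -/
theorem allowed_eq_empty_of_weakCertificate {Q : ι → Matrix n n ℝ} {τ : ι → ℝ}
    (hτ : IsWeakCertificate Q τ) : allowed Q = ∅ :=
  Set.eq_empty_of_subset_empty fun x hx => by
    obtain ⟨i, hi⟩ := exists_nonneg_of_weakCertificate hτ x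
    exact (not_le.mpr (hx.2 i) hi).elim

omit [DecidableEq n] in
/-- A strict certificate is a weak one (over a nonempty index type, `0` is not positive
definite, so `τ ≠ 0`). [cite: PolikTerlaky2007, §1.1 (the S-procedure)] -/
theorem IsStrictCertificate.isWeakCertificate [Nonempty n] {Q : ι → Matrix n n ℝ} {τ : ι → ℝ}
    (hτ : IsStrictCertificate Q τ) : IsWeakCertificate Q τ := by
  refine ⟨hτ.1, ?_, hτ.2.posSemidef⟩
  by_contra h
  push Not at h
  have hτ0 : ∀ i, τ i = 0 := fun i => le_antisymm (h i) (hτ.1 i)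
  have hsum : ∑ i, τ i • Q i = 0 := Finset.sum_eq_zero fun i _ => by rw [hτ0 i, zero_smul]
  have hpos := hτ.2.dotProduct_mulVec_pos (x := fun _ => (1 : ℝ))
    (by rw [Function.ne_iff]; exact ⟨Classical.arbitrary n, one_ne_zero⟩)
  rw [hsum, zero_mulVec, dotProduct_zero] at hpos
  exact lt_irrefl _ hpos

/-! ## 3. Completeness of the strict certificate for the relaxation -/

omit [Fintype n] [DecidableEq n] in
/-- `∑ τ_i Q_i` is symmetric for symmetric `Q_i` and real `τ`.
[cite: PolikTerlaky2007, §2.3 (2.30) (the LMI `∑ yᵢ Hᵢ`)] -/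
theorem isHermitian_sum_smul {Q : ι → Matrix n n ℝ} (hQ : ∀ i, (Q i).IsHermitian) (τ : ι → ℝ) :
    (∑ i, τ i • Q i).IsHermitian := by
  refine Finset.sum_induction _ (fun M : Matrix n n ℝ => M.IsHermitian)
    (fun a b ha hb => ha.add hb) isHermitian_zero fun i _ => ?_
  show (τ i • Q i)ᴴ = τ i • Q i
  rw [conjTranspose_smul, (hQ i).eq, star_trivial]

/-- **COMPLETENESS (theorem of the alternative for the relaxation).**  For symmetric `Q_i`: if NO
`X ⪰ 0`, `X ≠ 0` has `Tr(X Q_i) ≤ 0` for all `i`, then some `τ ≥ 0` has `∑ τ_i Q_i ≻ 0`.  This is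
Blekherman–Parrilo–Thomas Thm 2.28 (i) ⟹ (ii) (Exercise 2.32) for the proper cone
`K = S^m_+ × ℝ^K_+` and the map `(X, s) ↦ (Tr(X Q_i) + s_i)_i`: `K ∩ ker = {0}` is
relaxation-infeasibility, and `A*τ = (∑ τ_i Q_i, τ) ∈ int K*` is `∑ τ_i Q_i ≻ 0, τ > 0`.  Proof
here: separate the compact convex set `{(Tr(B Q_i))_i : B ⪰ 0, Tr B = 1}` from the closed convex
orthant `{y ≤ 0}`; the separating functional `y ↦ ∑ c_i y_i` has `c ≤ 0` (homogeneity of the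
orthant) and `∑ (−c_i) Tr(B Q_i) > 0` on the spectraplex, whence `∑ (−c_i) Q_i ≻ 0` (test
`B = x xᵀ/|x|²`). [cite: BlekhermanParriloThomas2012, Ch. 2 Thm 2.28 (i)⇒(ii) and Exercise 2.32
(infeasibility certificates)] -/
theorem exists_strictCertificate_of_relaxation_infeasible {Q : ι → Matrix n n ℝ}
    (hQ : ∀ i, (Q i).IsHermitian) (h : ∀ X, ¬ IsRelaxedSolution Q X) :
    ∃ τ, IsStrictCertificate Q τ := by
  classical
  -- the linear constraint map `X ↦ (Tr(X Q_i))_i`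
  let L : Matrix n n ℝ →ₗ[ℝ] (ι → ℝ) :=
    { toFun := fun X i => (X * Q i).trace
      map_add' := fun X Y => by ext i; simp [Matrix.add_mul, trace_add]
      map_smul' := fun c X => by ext i; simp [trace_smul] }
  have hLc : Continuous L :=
    continuous_pi fun i => (continuous_id.matrix_mul continuous_const).matrix_trace
  -- the spectraplex and its image
  set K : Set (Matrix n n ℝ) := {B | IsSpectraplex B} with hK
  have hKconv : Convex ℝ K := by
    intro B₁ hB₁ B₂ hB₂ a b _ hb hab
    have ha' : a = 1 - b := by linarith
    rw [ha']
    exact IsSpectraplex.convexComb hB₁ hB₂ hb (by linarith)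
  -- the nonpositive orthant
  set T : Set (ι → ℝ) := {y | ∀ i, y i ≤ 0} with hT
  have hTconv : Convex ℝ T := by
    intro y hy z hz a b ha hb _ i
    simp only [Pi.add_apply, Pi.smul_apply, smul_eq_mul]
    nlinarith [hy i, hz i]
  have hTclosed : IsClosed T := by
    have hT' : T = ⋂ i, {y : ι → ℝ | y i ≤ 0} := by ext y; simp [hT]
    rw [hT']
    exact isClosed_iInter fun i => isClosed_le (continuous_apply i) continuous_const
  have hdisj : Disjoint (L '' K) T := by
    rw [Set.disjoint_left]
    rintro _ ⟨B, hB, rfl⟩ hBT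
    refine h B ⟨hB.posSemidef, fun hB0 => ?_, fun i => hBT i⟩
    have h1 := hB.trace_eq_one
    rw [hB0, trace_zero] at h1
    exact zero_ne_one h1
  obtain ⟨f, u, v, hfK, huv, hfT⟩ := geometric_hahn_banach_compact_closed (hKconv.linear_image L)
    (isCompact_setOf_isSpectraplex.image hLc) hTconv hTclosed hdisj
  -- `f` is nonnegative on the orthant (homogeneity) and `v < 0`
  have hv : v < 0 := by simpa using hfT 0 fun _ => le_rfl
  have hfT' : ∀ b ∈ T, 0 ≤ f b := by
    intro b hb
    by_contra hneg
    push Not at hneg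
    have hc : 0 < v / f b := div_pos_of_neg_of_neg hv hneg
    have hmem : (v / f b) • b ∈ T := fun i => by
      simp only [Pi.smul_apply, smul_eq_mul]
      exact mul_nonpos_of_nonneg_of_nonpos hc.le (hb i)
    have := hfT _ hmem
    rw [map_smul, smul_eq_mul, div_mul_cancel₀ _ hneg.ne] at this
    exact lt_irrefl _ this
  -- coordinates of `f`: `f y = ∑ y_i f(e_i)`, and `τ_i := -f(e_i) ≥ 0`
  set e : ι → (ι → ℝ) := fun i j => if i = j then 1 else 0 with he
  have hf_apply : ∀ y : ι → ℝ, f y = ∑ i, y i * f (e i) := fun y => by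
    have := LinearMap.pi_apply_eq_sum_univ (f : (ι → ℝ) →ₗ[ℝ] ℝ) y
    simpa [he] using this
  refine ⟨fun i => -f (e i), fun i => ?_, ?_⟩
  · have hmem : -e i ∈ T := fun j => by
      simp only [Pi.neg_apply, he]
      split_ifs <;> norm_num
    have := hfT' _ hmem
    rw [map_neg] at this
    exact this
  -- `∑ τ_i Tr(B Q_i) > 0` on the spectraplex, then positive definiteness via `B = x xᵀ / |x|²`
  have hposK : ∀ B, IsSpectraplex B → 0 < ∑ i, -f (e i) * (B * Q i).trace := fun B hB => by
    have h1 : f (L B) < u := hfK _ ⟨B, hB, rfl⟩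
    have h2 : f (L B) = ∑ i, (B * Q i).trace * f (e i) := hf_apply _
    have h3 : ∑ i, -f (e i) * (B * Q i).trace = -f (L B) := by
      rw [h2, ← Finset.sum_neg_distrib]
      exact Finset.sum_congr rfl fun i _ => by ring
    rw [h3]
    linarith
  refine PosDef.of_dotProduct_mulVec_pos (isHermitian_sum_smul hQ _) fun x hx => ?_
  rw [star_trivial, quad_sum_smul]
  have hxx : 0 < x ⬝ᵥ x := by simpa using dotProduct_star_self_pos_iff.mpr hx
  have hP : (vecMulVec x x).PosSemidef := by simpa using posSemidef_vecMulVec_self_star x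
  have htr : 0 < (vecMulVec x x).trace := by rwa [trace_vecMulVec]
  have hB := hposK _ (IsSpectraplex.of_posSemidef_div hP htr)
  have hrw : ∀ i, ((vecMulVec x x).trace⁻¹ • vecMulVec x x * Q i).trace =
      (vecMulVec x x).trace⁻¹ * (x ⬝ᵥ Q i *ᵥ x) := fun i => by
    rw [Matrix.smul_mul, trace_smul, smul_eq_mul, trace_vecMulVec_mul]
  simp_rw [hrw] at hB
  have hfac : ∑ i, -f (e i) * ((vecMulVec x x).trace⁻¹ * (x ⬝ᵥ Q i *ᵥ x)) =
      (vecMulVec x x).trace⁻¹ * ∑ i, -f (e i) * (x ⬝ᵥ Q i *ᵥ x) := by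
    rw [Finset.mul_sum]
    exact Finset.sum_congr rfl fun i _ => by ring
  rw [hfac] at hB
  by_contra hle
  push Not at hle
  exact absurd hB (not_lt.mpr (mul_nonpos_of_nonneg_of_nonpos (inv_nonneg.mpr htr.le) hle))

/-- **The relaxation is infeasible iff a strict certificate exists** (symmetric `Q_i`): the SDP test
of §3.4.3 and the S-procedure LMI `∃ τ ≥ 0, ∑ τ_i Q_i ≻ 0` decide the same thing.
[cite: BlekhermanParriloThomas2012, Ch. 2 Thm 2.28 (i)⇔(ii) (conic infeasibility certificates)] -/
theorem relaxation_infeasible_iff_exists_strictCertificate {Q : ι → Matrix n n ℝ}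
    (hQ : ∀ i, (Q i).IsHermitian) :
    (∀ X, ¬ IsRelaxedSolution Q X) ↔ ∃ τ, IsStrictCertificate Q τ :=
  ⟨exists_strictCertificate_of_relaxation_infeasible hQ,
    fun ⟨_, hτ⟩ => relaxation_infeasible_of_strictCertificate hτ⟩

/-! ## 4. Two forms: exactness of the weak certificate (Yuan's lemma) -/

/-- The quadratic form `x ↦ xᵀ A x` of a real square matrix.
[cite: PolikTerlaky2007, §2.4 (matrix form of the S-lemma)] -/
private def qf (A : Matrix n n ℝ) : QuadraticForm ℝ (n → ℝ) :=
  LinearMap.BilinMap.toQuadraticMap (Matrix.toLinearMap₂' ℝ A)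

/-- `qf A x = xᵀ A x`. [cite: PolikTerlaky2007, §2.4 (matrix form of the S-lemma)] -/
@[simp] private theorem qf_apply (A : Matrix n n ℝ) (x : n → ℝ) : qf A x = x ⬝ᵥ A *ᵥ x := by
  rw [qf, LinearMap.BilinMap.toQuadraticMap_apply, Matrix.toLinearMap₂'_apply']

omit [Fintype n] [DecidableEq n] in
/-- `c • A` is symmetric for symmetric `A`, real `c`. [cite: PolikTerlaky2007, §2.4 (2.43)] -/
theorem isHermitian_smul_real {A : Matrix n n ℝ} (hA : A.IsHermitian) (c : ℝ) :
    (c • A).IsHermitian := by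
  show (c • A)ᴴ = c • A
  rw [conjTranspose_smul, hA.eq, star_trivial]

/-- **Two forms** (Yuan's lemma, Pólik–Terlaky Lemma 2.7, in matrix form): if every `x ≠ 0` has
`xᵀ A x ≥ 0` or `xᵀ B x ≥ 0`, then `μ A + ν B ⪰ 0` for some `μ, ν ≥ 0`, `μ + ν = 1`.
[cite: PolikTerlaky2007, Lemma 2.7 (Yuan 1990)] -/
theorem exists_convexComb_posSemidef_of_two {A B : Matrix n n ℝ} (hA : A.IsHermitian)
    (hB : B.IsHermitian) (h : ∀ x, x ≠ 0 → 0 ≤ x ⬝ᵥ A *ᵥ x ∨ 0 ≤ x ⬝ᵥ B *ᵥ x) :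
    ∃ μ ν : ℝ, 0 ≤ μ ∧ 0 ≤ ν ∧ μ + ν = 1 ∧ (μ • A + ν • B).PosSemidef := by
  have h' : ∀ x, 0 ≤ max (qf A x) (qf B x) := fun x => by
    by_cases hx : x = 0
    · simp [hx]
    · exact le_max_iff.mpr (by simpa using h x hx)
  obtain ⟨μ, ν, hμ, hν, h1, hq⟩ := yuan_lemma' (qf A) (qf B) h'
  refine ⟨μ, ν, hμ, hν, h1, PosSemidef.of_dotProduct_mulVec_nonneg
    ((isHermitian_smul_real hA μ).add (isHermitian_smul_real hB ν)) fun x => ?_⟩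
  rw [star_trivial, add_mulVec, dotProduct_add, smul_mulVec, smul_mulVec, dotProduct_smul,
    dotProduct_smul, smul_eq_mul, smul_eq_mul]
  simpa using hq x

/-- **`K = 2` is exact**: for two symmetric forms, `𝒜 = ∅` iff a weak certificate exists
(contrast §5).
[cite: PolikTerlaky2007, Lemma 2.7 (Yuan [82]) and Theorem 2.2 (the S-lemma: two forms)] -/
theorem allowed_pair_eq_empty_iff {A B : Matrix n n ℝ} (hA : A.IsHermitian) (hB : B.IsHermitian) :
    allowed ![A, B] = ∅ ↔ ∃ τ, IsWeakCertificate ![A, B] τ := by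
  constructor
  · intro h
    have h' : ∀ x, x ≠ 0 → 0 ≤ x ⬝ᵥ A *ᵥ x ∨ 0 ≤ x ⬝ᵥ B *ᵥ x := fun x hx => by
      by_contra hc
      push Not at hc
      have hmem : x ∈ allowed ![A, B] := ⟨hx, fun i => by fin_cases i <;> simp [hc.1, hc.2]⟩
      rw [h] at hmem
      exact hmem
    obtain ⟨μ, ν, hμ, hν, h1, hpsd⟩ := exists_convexComb_posSemidef_of_two hA hB h'
    refine ⟨![μ, ν], fun i => by fin_cases i <;> simpa, ?_, by simpa [Fin.sum_univ_two] using hpsd⟩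
    rcases lt_or_ge 0 μ with hμ' | hμ'
    · exact ⟨0, by simpa using hμ'⟩
    · exact ⟨1, by simp; linarith⟩
  · rintro ⟨τ, hτ⟩
    exact allowed_eq_empty_of_weakCertificate hτ

/-! ## 5. The gap for more forms: strict exclusion with a feasible relaxation -/

/-- Four forms on `ℝ²`: `Q_i = ¼·1 − u_i u_iᵀ` for the unit vectors `u_i` along the lines at 0°,
90°, 45°, 135° (`xᵀ Q_i x > 0` iff the angle from `x` to the line `u_i` exceeds 60°).  An
instance of the failure of the S-procedure with more than two forms.
[cite: PolikTerlaky2007, §3.3.1 Lemmas 3.11–3.12 and §3.3.2 Prop. 3.13 (counterexamples with four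
forms on `ℝ³`, three on `ℝ²`; this instance: four forms on `ℝ²`, lines at multiples of 45°)] -/
noncomputable def exQ : Fin 4 → Matrix (Fin 2) (Fin 2) ℝ :=
  ![!![-3/4, 0; 0, 1/4], !![1/4, 0; 0, -3/4], !![-1/4, -1/2; -1/2, -1/4],
    !![-1/4, 1/2; 1/2, -1/4]]

/-- The four forms: `−¾x² + ¼y²`, `¼x² − ¾y²`, `−¼x² − xy − ¼y²`, `−¼x² + xy − ¼y²`.
[cite: PolikTerlaky2007, §3.3.1 (counterexamples; this instance)] -/
theorem exQ_forms (v : Fin 2 → ℝ) :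
    v ⬝ᵥ exQ 0 *ᵥ v = -(3 / 4) * v 0 ^ 2 + 1 / 4 * v 1 ^ 2 ∧
    v ⬝ᵥ exQ 1 *ᵥ v = 1 / 4 * v 0 ^ 2 - 3 / 4 * v 1 ^ 2 ∧
    v ⬝ᵥ exQ 2 *ᵥ v = -(1 / 4) * v 0 ^ 2 - v 0 * v 1 - 1 / 4 * v 1 ^ 2 ∧
    v ⬝ᵥ exQ 3 *ᵥ v = -(1 / 4) * v 0 ^ 2 + v 0 * v 1 - 1 / 4 * v 1 ^ 2 := by
  refine ⟨?_, ?_, ?_, ?_⟩ <;> simp [exQ, Matrix.mulVec, dotProduct, Fin.sum_univ_two] <;> ring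

/-- The `Q_i` are symmetric. [cite: PolikTerlaky2007, §3.3.1 (this instance)] -/
theorem exQ_isHermitian (i : Fin 4) : (exQ i).IsHermitian := by
  fin_cases i <;>
    exact Matrix.IsHermitian.ext fun a b => by fin_cases a <;> fin_cases b <;> simp [exQ]

/-- `Tr Q_i = −½`. [cite: PolikTerlaky2007, §3.3.1 (this instance)] -/
theorem exQ_trace (i : Fin 4) : (exQ i).trace = -(1 / 2) := by
  fin_cases i <;> simp [exQ, Matrix.trace, Fin.sum_univ_two] <;> norm_num

/-- **Every direction is strictly excluded**: each `v ≠ 0` has `vᵀ Q_i v > 0` for some `i` (no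
direction is within 60° of all four lines; algebraically `(3x²−y²)(3y²−x²) ≥ 0` and
`(x²+y²)² ≥ 16x²y²` force `x = y = 0`).  So `𝒜 = ∅` here.
[cite: PolikTerlaky2007, §3.3.1 Lemma 3.11 (unsolvable system; this instance)] -/
theorem ex_cover (v : Fin 2 → ℝ) (hv : v ≠ 0) : ∃ i, 0 < v ⬝ᵥ exQ i *ᵥ v := by
  by_contra h
  push Not at h
  obtain ⟨e0, e1, e2, e3⟩ := exQ_forms v
  have h0 := h 0
  have h1 := h 1
  have h2 := h 2
  have h3 := h 3
  rw [e0] at h0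
  rw [e1] at h1
  rw [e2] at h2
  rw [e3] at h3
  have hA : 16 * (v 0 * v 1) ^ 2 ≤ (v 0 ^ 2 + v 1 ^ 2) ^ 2 := by
    nlinarith [mul_nonneg_of_nonpos_of_nonpos h2 h3]
  have hB : 3 * (v 0 ^ 4 + v 1 ^ 4) ≤ 10 * (v 0 * v 1) ^ 2 := by
    nlinarith [mul_nonneg_of_nonpos_of_nonpos h0 h1]
  have hC : (v 0 * v 1) ^ 2 ≤ 0 := by nlinarith [sq_nonneg (v 0 ^ 2 - v 1 ^ 2)]
  have h4 : v 0 ^ 4 + v 1 ^ 4 ≤ 0 := by nlinarith [sq_nonneg (v 0 * v 1)]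
  have hx4 : (0 : ℝ) ≤ v 0 ^ 4 := by positivity
  have hy4 : (0 : ℝ) ≤ v 1 ^ 4 := by positivity
  have hx : v 0 = 0 := (pow_eq_zero_iff (n := 4) (by norm_num)).mp (by linarith)
  have hy : v 1 = 0 := (pow_eq_zero_iff (n := 4) (by norm_num)).mp (by linarith)
  exact hv (by ext i; fin_cases i <;> simp [hx, hy])

/-- … hence the allowed region of the example is empty.
[cite: PolikTerlaky2007, §3.3.1 Lemma 3.11 (this instance)] -/
theorem ex_allowed_eq_empty : allowed exQ = ∅ :=
  Set.eq_empty_of_subset_empty fun v hv => by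
    obtain ⟨i, hi⟩ := ex_cover v hv.1
    exact (lt_asymm hi (hv.2 i)).elim

/-- **… yet the relaxation is feasible**: `X = 1` has `X ⪰ 0`, `X ≠ 0`, `Tr(X Q_i) = −½ ≤ 0`.
[cite: PolikTerlaky2007, §3.3.1 Lemma 3.12 (the matrix `X` of (3.18); this instance)] -/
theorem ex_isRelaxedSolution : IsRelaxedSolution exQ 1 :=
  ⟨PosDef.one.posSemidef, one_ne_zero, fun i => by rw [Matrix.one_mul, exQ_trace]; norm_num⟩

/-- **… and no weak certificate exists** (`Tr(∑ τ_i Q_i) = −½ ∑ τ_i < 0` contradicts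
`∑ τ_i Q_i ⪰ 0`), a fortiori no strict one: with more than two forms, emptiness of `𝒜` is in
general NOT equivalent to relaxation-infeasibility.
[cite: PolikTerlaky2007, §3.3.1 Lemma 3.12 (proof pattern: a PSD `X` with `Q_i • X < 0` blocks
all nonnegative multipliers; this instance)] -/
theorem ex_no_weakCertificate : ¬ ∃ τ, IsWeakCertificate exQ τ := by
  rintro ⟨τ, h0, ⟨j, hj⟩, hpsd⟩
  have htr := hpsd.trace_nonneg
  rw [trace_sum] at htr
  simp_rw [trace_smul, exQ_trace, smul_eq_mul] at htr
  have hlt : ∑ i, τ i * -(1 / 2 : ℝ) < ∑ _i : Fin 4, (0 : ℝ) :=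
    Finset.sum_lt_sum (fun i _ => by nlinarith [h0 i]) ⟨j, Finset.mem_univ _, by nlinarith⟩
  rw [Finset.sum_const_zero] at hlt
  exact absurd htr (not_le.mpr hlt)

/-- No strict certificate exists for the example either (the relaxation is feasible).
[cite: PolikTerlaky2007, §3.3.1 Lemma 3.12 (this instance)] -/
theorem ex_no_strictCertificate : ¬ ∃ τ, IsStrictCertificate exQ τ :=
  fun ⟨_, hτ⟩ => relaxation_infeasible_of_strictCertificate hτ 1 ex_isRelaxedSolution

end Literature.Analysis.Convexity.SemidefiniteRelaxationQCQP
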